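import Summits.BirchSwinnertonDyer.BirchSwinnertonDyer.Theorems.EdixhovenFibreFiveSevenUnstarredOrdinaryManinUnitOfSL2NeronValuesBar
import HarnessLib

/-!
# Manin's `p`-part at every lattice-optimal datum at an additive `p > 7` with a (G)-ORDINARY member, GRANTED {P1-bar, modularity} and a REC socket AT THE MEMBERS
# OF THE CLASS — the `p > 7` lever re-keyed (route `EdixhovenFibreFiveSeven`, line `kato-lever`; seat `bsd-line-edix-p4` g31, width)

HONEST FRAMING. ONE tool theorem (no definition, no named fact, no instance, no `sorry`; file-local instance keys on `ℚ_v` byte-identical to the accepted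
`…CellsOfRecTowerAtIntrinsicAlt` l.65–69); helper toward PSMU (stmt-BirchSwinnertonDyer-22638) / GE11 (stmt-BirchSwinnertonDyer-23885) of route TeichmullerTwistDescent and
AKR crux #7 `ManinFrameResidueProperR` (stmt-BirchSwinnertonDyer-20709), whose conditional closers of record (`TeichmullerTwistDescentManinSideOfReciprocityLaw`,
`AdditiveKolyvaginRoadManinFrameResidueProperROfReciprocityLaw`, LEAD g19) take hT₂ / [REC-tower] at `p > 7` through
`OptimalManinUnitFiveSevenOfReciprocityLaw.not_dvd_optimal_c_of_typeGOrd_member_of_expStarTower_of_sl2NeronValuesBar`. Nothing is closed; **BSD is not proved by any of this.**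

WHAT. The companion of `UnstarredOrdinaryManinUnitOfSL2NeronValuesBar.not_dvd_optimal_c_of_sl2NeronValuesBar_of_recAt` (the `p ∈ {5, 7}` master theorem on a REC socket keyed
by the cell data) at `p > 7`, where there is no Kosters–Pannekoek branch and the socket can be keyed by CLASS MEMBERSHIP:

* ★★★ `not_dvd_optimal_c_of_typeGOrd_member_of_sl2NeronValuesBar_of_recAtMembers` — `W/ℚ` globally minimal, additive at `p > 7` with `E[p]` irreducible and SOME
  isogenous curve (G)-ordinary at `p`, `D` lattice-optimal at any level ⇒ `p ∤ c(D)`, GRANTED P1-bar, modularity and `hREC` = the body of [REC-tower] at every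
  cyclotomic tower `ℚ_v ⊆ ℚ(ζ_m)_w`, `p ∤ m`, for EVERY globally minimal member `W′ ∼ W` (the conclusion shape of the line's cell theorems). Proof = g19's
  `not_dvd_optimal_c_of_typeGOrd_member_of_expStarTower_of_sl2NeronValuesBar` VERBATIM (the `p > 7` tame-twist lever `not_dvd_c_of_tameTwistL_at`; de Rham by
  `isDeRham_restrictedRationalTateRep_adicCompletion_rat_of_typeGOrd` at the (G)-ordinary member, moved along the isogeny) with the universal hT₂ replaced by
  `katoNeronBody_of_sl2NeronValuesBar_of_rangeAt` ∘ `…RecTowerAtBridgeAlt.rangeAt_of_recTowerAtAlt` ∘ `hREC`.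

The socket is discharged by the LEAD's (edix-p1 g33) any-prime (G)-ordinary REC theorems (`recTowerOrdinaryUnstarred_of_typeGOrd` and starred twins, in flight) together
with `TypeGOrd` / cell-data transport along the isogeny; then PSMU / GE11 / AKR #7 / the TTD Manin side / the rung ⟸ {modularity, P1-bar}. CONDITIONAL; items OPEN.

References: [Kato2004Asterisque] Thm. 6.6 (1), (8.1.3), Thm. 9.7; [Kato1993LNM1553] Ch. II Prop. 1.2.3, Ex. 1.3.5, Thm. 1.4.1 (3)–(4); [DokchitserDokchitser2015LocalInvariants]
Thm. 3.2; [KrausOesterle1992] Prop. 1; [Stevens1989] Lemma (5.2).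
-/

set_option autoImplicit false
-- the Theorems namespace of a single-conjunct summit repeats the summit name by design (D-0017)
set_option linter.dupNamespace false

noncomputable section

open scoped Classical MatrixGroups NumberField NNReal

open WeierstrassCurve NumberField IsDedekindDomain Field ValuativeRel
  Literature.NumberTheory.EllipticCurves Literature.NumberTheory.EllipticCurves.ModularForms
  Literature.NumberTheory.EllipticCurves.Rank1Residual Literature.NumberTheory.EllipticCurves.Kato2004
  Literature.NumberTheory.DiophantineGeometry Rat.HeightOneSpectrum
  Literature.NumberTheory.PAdicHodge Literature.NumberTheory.GaloisRepresentations
  Literature.NumberTheory.GaloisRepresentations.IsNonarchimedeanLocalField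
  Literature.NumberTheory.GaloisRepresentations.PeriodRingData
  Summit.BirchSwinnertonDyer.Rank1Residual Summit.BirchSwinnertonDyer.Rank1Residual.Additive
  Summit.BirchSwinnertonDyer.Rank1Residual.GaloisImage
  Summit.BirchSwinnertonDyer.BirchSwinnertonDyer.Theorems
  Summit.BirchSwinnertonDyer.BirchSwinnertonDyer.Theorems.KatoAssemblySocketAt
  Summit.BirchSwinnertonDyer.BirchSwinnertonDyer.Theorems.ManinFrameResidueProperRTameTwistAt
  Summit.BirchSwinnertonDyer.BirchSwinnertonDyer.Theorems.StarredOptimalManinUnitFiveSevenAssemblyAtBarOfRangeAt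
  Summit.BirchSwinnertonDyer.BirchSwinnertonDyer.Theorems.KimAtThreeDeepLowerExpStarOmega
  Summit.BirchSwinnertonDyer.BirchSwinnertonDyer.Theorems.KimAtThreeDeepLowerExpStarOmegaPlace
  CongruenceSubgroup Complex
open Summit.BirchSwinnertonDyer.BirchSwinnertonDyer.Theorems.KimAtThreeDeepUpperTowerLattice (fact_natCast_mem_primesEquiv_symm)
open Literature.NumberTheory.EllipticCurves.FormalGroupChart (padicLogPointFiniteExt)

namespace Summit.BirchSwinnertonDyer.BirchSwinnertonDyer.Theorems.TypeGOrdMemberManinUnitOfSL2NeronValuesBar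

-- FILE-LOCAL instance keys, byte-identical to the accepted `…CellsOfRecTowerAtIntrinsicAlt.lean` l.65–69 (no library instance is
-- overridden outside this file): the `Fact (p ∈ v_p)` key and the local-field structures on `ℚ_v = Place.Completion (inr v)`, under
-- which the rangeAt socket `katoNeronBody_of_sl2NeronValuesBar_of_rangeAt` is stated.
attribute [local instance] fact_natCast_mem_primesEquiv_symm
attribute [local instance 100000] NumberField.Place.instAlgebraCompletion
attribute [local instance] valuativeRelPlace topologicalSpacePlace
attribute [local instance] isNonarchimedeanLocalField_place charZero_place
attribute [local instance] padicAlgebraPlace fact_not_isUnit_place isAdicComplete_place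

variable {p : ℕ} [hp : Fact p.Prime]

set_option maxHeartbeats 800000 in
/-- ★★★ **Manin's `p`-part at every lattice-optimal datum of every `W/ℚ` additive at `p > 7` with `E[p]` irreducible and SOME isogenous curve (G)-ordinary at `p`,
GRANTED P1-bar, modularity and the body of [REC-tower] at the cyclotomic towers for every globally minimal MEMBER of the class of `W`.** The `p > 7` tame-twist lever
`not_dvd_c_of_tameTwistL_at` at `W` through the per-class socket `katoNeronBody_of_sl2NeronValuesBar_of_rangeAt`, its (S5b-tower) input at each member `W′ ∼ W`
being `…RecTowerAtBridgeAlt.rangeAt_of_recTowerAtAlt` of the displayed `hREC W′`, its de Rham input the tree theorem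
`isDeRham_restrictedRationalTateRep_adicCompletion_rat_of_typeGOrd` at the (G)-ordinary member moved along the isogeny; `a_ℓ = ±1` at `ℓ ∥ N` by
`lFunction_apply_prime_eq_one_or_eq_neg_one_of_mult`. = g19's `not_dvd_optimal_c_of_typeGOrd_member_of_expStarTower_of_sl2NeronValuesBar` with hT₂ ↦ `hREC`.
CONDITIONAL on the cite-only P1-bar / modularity and the displayed socket; nothing is closed.
[cite: Kato2004Asterisque, Thm. 6.6 (1) (p. 163), (8.1.3) (p. 180), Thm. 9.7 (p. 189)] [cite: Kato1993LNM1553, Ch. II Prop. 1.2.3, Ex. 1.3.5 and Thm. 1.4.1 (3)–(4)]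
[cite: DokchitserDokchitser2015LocalInvariants, Thm. 3.2] [cite: KrausOesterle1992, Prop. 1] -/
theorem not_dvd_optimal_c_of_typeGOrd_member_of_sl2NeronValuesBar_of_recAtMembers
    (hP1 : exists_member_sl2ZetaElement_neron_values_bar) (hnf : exists_isNewformOf)
    (W : WeierstrassCurve ℚ) [W.IsElliptic] [W.IsGloballyMinimal] {N : ℕ} [NeZero N]
    (D : ModularParametrizationData W N) (hp7 : 7 < p) (hadd : Addv W p) (hirr : Irr W p)
    (hG : ∃ (W' : WeierstrassCurve ℚ) (_ : W'.IsElliptic) (_ : W'.IsGloballyMinimal), IsIsogenous W W' ∧ TypeGOrd W' p)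
    -- THE SOCKET: the body of [REC-tower] at every cyclotomic tower `ℚ_v ⊆ ℚ(ζ_m)_w`, `p ∤ m`, for every globally minimal member `W′ ∼ W`
    (hREC : ∀ (W' : WeierstrassCurve ℚ) [W'.IsElliptic] [W'.IsGloballyMinimal], IsIsogenous W W' →
      ∀ (m : ℕ) [NeZero m], ¬ p ∣ m →
      ∀ (w : ((primesEquiv (R := 𝓞 ℚ)).symm ⟨p, hp.out⟩).Extension (𝓞 (CyclotomicField m ℚ))) (hw : ((p : ℕ) : 𝓞 (CyclotomicField m ℚ)) ∈ w.1.asIdeal)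
      [CharZero (w.1.adicCompletion (CyclotomicField m ℚ))] [Fact (¬ IsUnit ((p : ℕ) : integerC (w.1.adicCompletion (CyclotomicField m ℚ))))]
      [IsAdicComplete (Ideal.span {((p : ℕ) : integerC (w.1.adicCompletion (CyclotomicField m ℚ)))}) (integerC (w.1.adicCompletion (CyclotomicField m ℚ)))]
      (hL : valuation (w.1.adicCompletion (CyclotomicField m ℚ)) ((p : ℕ) : (w.1.adicCompletion (CyclotomicField m ℚ))) < 1), letI := LocalField.adicCompletionPadicAlgebra w.1 p hw
      letI : Algebra (Place.Completion (K := ℚ) (Sum.inr ((primesEquiv (R := 𝓞 ℚ)).symm ⟨p, hp.out⟩))) (w.1.adicCompletion (CyclotomicField m ℚ)) :=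
      inferInstanceAs (Algebra (((primesEquiv (R := 𝓞 ℚ)).symm ⟨p, hp.out⟩).adicCompletion ℚ) (w.1.adicCompletion (CyclotomicField m ℚ)))
      ∀ (wv : Valuation (Place.Completion (Sum.inr ((primesEquiv (R := 𝓞 ℚ)).symm ⟨p, hp.out⟩) : Place ℚ)) ℝ≥0) [wv.Compatible]
      [(W'.baseChange (Place.Completion (Sum.inr ((primesEquiv (R := 𝓞 ℚ)).symm ⟨p, hp.out⟩) : Place ℚ))).IsIntegral wv.integer]
      (ν : Valuation (w.1.adicCompletion (CyclotomicField m ℚ)) ℝ≥0) [ν.Compatible] [(W'.baseChange (w.1.adicCompletion (CyclotomicField m ℚ))).IsIntegral ν.integer]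
      (e : (k : ℕ) → geomTorsion W' ((p ^ k : ℕ) : ℤ) → geomTorsion W' ((p ^ k : ℕ) : ℤ) → AlgebraicClosure ℚ) (hμ : ∀ k S T, e k S T ^ (p ^ k) = 1)
      (hadd₁ : ∀ k S₁ S₂ T, e k (S₁ + S₂) T = e k S₁ T * e k S₂ T) (hadd₂ : ∀ k S T₁ T₂, e k S (T₁ + T₂) = e k S T₁ * e k S T₂)
      (hgal : ∀ k (σ : absoluteGaloisGroup ℚ) (S T : geomTorsion W' ((p ^ k : ℕ) : ℤ)), σ • e k S T = e k (σ • S) (σ • T))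
      (_hnondeg : ∀ k (T : geomTorsion W' ((p ^ k : ℕ) : ℤ)), (∀ S, e k S T = 1) → T = 0) (_halt : ∀ k (S : geomTorsion W' ((p ^ k : ℕ) : ℤ)), e k S S = 1)
      (hcompat : ∀ k (S T : geomTorsion W' ((p ^ (k + 1) : ℕ) : ℤ)),
      e k (torsionMulHom W' (p ^ (k + 1)) (p ^ k) p (pow_succ p k).symm S) (torsionMulHom W' (p ^ (k + 1)) (p ^ k) p (pow_succ p k).symm T) = e (k + 1) S T ^ p)
      (d₀ : LocalNeronLineAt W' p ((primesEquiv (R := 𝓞 ℚ)).symm ⟨p, hp.out⟩)) (d : LocalNeronLine W' hL ((galRestrictPlace ((primesEquiv (R := 𝓞 ℚ)).symm ⟨p, hp.out⟩)).comp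
      (absGaloisRestrict (Place.Completion (Sum.inr ((primesEquiv (R := 𝓞 ℚ)).symm ⟨p, hp.out⟩) : Place ℚ)) (w.1.adicCompletion (CyclotomicField m ℚ))))),
      (bdRPeriodRingData (valuation_place_lt_one p ((primesEquiv (R := 𝓞 ℚ)).symm ⟨p, hp.out⟩))).CupLogInjective (logCyclotomic p)
      (localRationalTateRep W' p (galRestrictPlace ((primesEquiv (R := 𝓞 ℚ)).symm ⟨p, hp.out⟩))) →
      (∀ z : contOneCocycles (localRationalTateRep W' p (galRestrictPlace ((primesEquiv (R := 𝓞 ℚ)).symm ⟨p, hp.out⟩))).toTopRep,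
      (bdRPeriodRingData (valuation_place_lt_one p ((primesEquiv (R := 𝓞 ℚ)).symm ⟨p, hp.out⟩))).HasDualExp (logCyclotomic p)
      (localRationalTateRep W' p (galRestrictPlace ((primesEquiv (R := 𝓞 ℚ)).symm ⟨p, hp.out⟩))) fun σ => z.1 σ) →
      (bdRPeriodRingData (F := (w.1.adicCompletion (CyclotomicField m ℚ))) (p := p) hL).CupLogInjective (logCyclotomic p) (localRationalTateRep W' p
      ((galRestrictPlace ((primesEquiv (R := 𝓞 ℚ)).symm ⟨p, hp.out⟩)).comp (absGaloisRestrict (Place.Completion (Sum.inr ((primesEquiv (R := 𝓞 ℚ)).symm ⟨p, hp.out⟩) : Place ℚ)) (w.1.adicCompletion (CyclotomicField m ℚ))))) →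
      (∀ z : contOneCocycles (localRationalTateRep W' p
      ((galRestrictPlace ((primesEquiv (R := 𝓞 ℚ)).symm ⟨p, hp.out⟩)).comp (absGaloisRestrict (Place.Completion (Sum.inr ((primesEquiv (R := 𝓞 ℚ)).symm ⟨p, hp.out⟩) : Place ℚ)) (w.1.adicCompletion (CyclotomicField m ℚ))))).toTopRep,
      (bdRPeriodRingData (F := (w.1.adicCompletion (CyclotomicField m ℚ))) (p := p) hL).HasDualExp (logCyclotomic p) (localRationalTateRep W' p
      ((galRestrictPlace ((primesEquiv (R := 𝓞 ℚ)).symm ⟨p, hp.out⟩)).comp (absGaloisRestrict (Place.Completion (Sum.inr ((primesEquiv (R := 𝓞 ℚ)).symm ⟨p, hp.out⟩) : Place ℚ)) (w.1.adicCompletion (CyclotomicField m ℚ)))))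
      fun σ => z.1 σ) → (∀ (η₀ : contOneCocycles (restrictedTateRep W' (Place.Completion (Sum.inr ((primesEquiv (R := 𝓞 ℚ)).symm ⟨p, hp.out⟩) : Place ℚ)) p).toTopRep)
      (ηT : contOneCocycles ((restrictedTateRep W' (Place.Completion (Sum.inr ((primesEquiv (R := 𝓞 ℚ)).symm ⟨p, hp.out⟩) : Place ℚ)) p).restrict
      (absGaloisRestrict (Place.Completion (Sum.inr ((primesEquiv (R := 𝓞 ℚ)).symm ⟨p, hp.out⟩) : Place ℚ)) (w.1.adicCompletion (CyclotomicField m ℚ)))).toTopRep),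
      (∀ σ, ηT.1 σ = η₀.1 (absGaloisRestrict (Place.Completion (Sum.inr ((primesEquiv (R := 𝓞 ℚ)).symm ⟨p, hp.out⟩) : Place ℚ)) (w.1.adicCompletion (CyclotomicField m ℚ)) σ)) →
      expStarCoordTower W' (F₀ := (Place.Completion (Sum.inr ((primesEquiv (R := 𝓞 ℚ)).symm ⟨p, hp.out⟩) : Place ℚ))) hL d ηT =
      algebraMap (Place.Completion (Sum.inr ((primesEquiv (R := 𝓞 ℚ)).symm ⟨p, hp.out⟩) : Place ℚ)) (w.1.adicCompletion (CyclotomicField m ℚ))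
      (expStarCoord W' (valuation_place_lt_one p ((primesEquiv (R := 𝓞 ℚ)).symm ⟨p, hp.out⟩)) d₀ η₀)) →
      ∃ c : (Place.Completion (Sum.inr ((primesEquiv (R := 𝓞 ℚ)).symm ⟨p, hp.out⟩) : Place ℚ)), c ≠ 0 ∧
      (∀ (η₀ : contOneCocycles (restrictedTateRep W' (Place.Completion (Sum.inr ((primesEquiv (R := 𝓞 ℚ)).symm ⟨p, hp.out⟩) : Place ℚ)) p).toTopRep)
      (P : (W'.baseChange (Place.Completion (Sum.inr ((primesEquiv (R := 𝓞 ℚ)).symm ⟨p, hp.out⟩) : Place ℚ))).toAffine.Point),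
      ((tatePairingPoint W' (Place.Completion (Sum.inr ((primesEquiv (R := 𝓞 ℚ)).symm ⟨p, hp.out⟩) : Place ℚ)) p e hμ hadd₁ hadd₂ hgal hcompat (oneCocycleClass _ η₀) P : ℤ_[p]) : ℚ_[p]) =
      Algebra.trace ℚ_[p] (Place.Completion (Sum.inr ((primesEquiv (R := 𝓞 ℚ)).symm ⟨p, hp.out⟩) : Place ℚ))
      (c * expStarCoord W' (valuation_place_lt_one p ((primesEquiv (R := 𝓞 ℚ)).symm ⟨p, hp.out⟩)) d₀ η₀ *
      padicLogPointFiniteExt wv (W'.baseChange (Place.Completion (Sum.inr ((primesEquiv (R := 𝓞 ℚ)).symm ⟨p, hp.out⟩) : Place ℚ))) p P)) ∧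
      (∀ (ηT : contOneCocycles ((restrictedTateRep W' (Place.Completion (Sum.inr ((primesEquiv (R := 𝓞 ℚ)).symm ⟨p, hp.out⟩) : Place ℚ)) p).restrict
      (absGaloisRestrict (Place.Completion (Sum.inr ((primesEquiv (R := 𝓞 ℚ)).symm ⟨p, hp.out⟩) : Place ℚ)) (w.1.adicCompletion (CyclotomicField m ℚ)))).toTopRep)
      (P : (W'.baseChange (w.1.adicCompletion (CyclotomicField m ℚ))).toAffine.Point),
      ((tatePairingPointTower W' (Place.Completion (Sum.inr ((primesEquiv (R := 𝓞 ℚ)).symm ⟨p, hp.out⟩) : Place ℚ)) e hμ hadd₁ hadd₂ hgal hcompat (oneCocycleClass _ ηT) P : ℤ_[p]) : ℚ_[p]) =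
      Algebra.trace ℚ_[p] (w.1.adicCompletion (CyclotomicField m ℚ))
      (algebraMap (Place.Completion (Sum.inr ((primesEquiv (R := 𝓞 ℚ)).symm ⟨p, hp.out⟩) : Place ℚ)) (w.1.adicCompletion (CyclotomicField m ℚ)) c * expStarCoordTower W' (F₀ := (Place.Completion (Sum.inr ((primesEquiv (R := 𝓞 ℚ)).symm ⟨p, hp.out⟩) : Place ℚ))) hL d ηT *
      padicLogPointFiniteExt ν (W'.baseChange (w.1.adicCompletion (CyclotomicField m ℚ))) p P)))
    (hopt : ∀ z ∈ D.L.lattice, ∃ w ∈ periodLattice D.f, z = D.c * w) :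
    ¬ (p : ℤ) ∣ D.c := by
  have hN : N = W.conductorNorm ℤ := IsNewformOf.level_eq_conductorNorm_of_exists_isNewformOf hnf D.isNewformOf
  subst hN
  have hpN : p ^ 2 ∣ W.conductorNorm ℤ := sq_dvd_conductorNorm_of_not_good_of_not_mult hadd
  have ha : ∀ ℓ ∈ (W.conductorNorm ℤ).primeFactors, ¬ ℓ ^ 2 ∣ W.conductorNorm ℤ →
      W.LFunction ℓ = 1 ∨ W.LFunction ℓ = -1 := by
    intro ℓ hℓ hℓ2
    haveI : Fact ℓ.Prime := ⟨Nat.prime_of_mem_primeFactors hℓ⟩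
    rcases hasGoodReductionAtPrime_or_hasMultiplicativeReductionAtPrime_of_not_sq_dvd_conductorNorm (V := W) hℓ2
      with hg | hmul
    · exact absurd (Nat.dvd_of_mem_primeFactors hℓ) (not_dvd_conductorNorm_of_hasGoodReductionAtPrime W hg)
    · exact KrausOesterle1992.lFunction_apply_prime_eq_one_or_eq_neg_one_of_mult W ℓ hmul
  obtain ⟨W₁, hE₁, hM₁, hiso₁, hG₁⟩ := hG
  haveI := hE₁
  refine not_dvd_c_of_tameTwistL_at W ?_ D hopt hp7 hadd hirr hpN ha
  intro M _ g hg hp7' hng hnm hirr' m _ hcop χ hχ hχ1 hord' ϖ r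
  refine katoNeronBody_of_sl2NeronValuesBar_of_rangeAt cupLogInjective_and_hasDualExp_of_isDeRham_holds hP1 W p
    ?_ g hg (by omega) hng hnm hirr' m hcop ?_ (Or.inl hp7') χ hχ hχ1 hord' ϖ r
  · intro v hpv _ _ _ hp' _
    exact isDeRham_restrictedRationalTateRep_of_isIsogenous hp' hiso₁.symm_of_charZero
      (isDeRham_restrictedRationalTateRep_adicCompletion_rat_of_typeGOrd W₁ p hG₁ v hpv hp')
  · intro W' _ _ hiso' w hw _ _ _ hL'
    letI := LocalField.adicCompletionPadicAlgebra w.1 p hw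
    letI : Algebra (Place.Completion (K := ℚ) (Sum.inr ((primesEquiv (R := 𝓞 ℚ)).symm ⟨p, hp.out⟩)))
        (w.1.adicCompletion (CyclotomicField m ℚ)) :=
      inferInstanceAs (Algebra ((((primesEquiv (R := 𝓞 ℚ)).symm ⟨p, hp.out⟩)).adicCompletion ℚ)
        (w.1.adicCompletion (CyclotomicField m ℚ)))
    exact StarredOptimalManinUnitFiveSevenRecTowerAtBridgeAlt.rangeAt_of_recTowerAtAlt W' p ((primesEquiv (R := 𝓞 ℚ)).symm ⟨p, hp.out⟩) hL'
      (hREC W' hiso' m (KatoAssemblySocket.not_dvd_of_coprime_mul hcop) w hw hL')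

end Summit.BirchSwinnertonDyer.BirchSwinnertonDyer.Theorems.TypeGOrdMemberManinUnitOfSL2NeronValuesBar

end
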